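import Literature.AlgebraicGeometry.Frobenioids.ArchimedeanProp35iiiCounterexample
import Literature.AlgebraicGeometry.Frobenioids.ArchimedeanProp35iSaturationIff
import Literature.AlgebraicGeometry.Frobenioids.ArchimedeanPointBaseProp35
import Literature.AlgebraicGeometry.Frobenioids.ArchimedeanPointBaseProp35N
import HarnessLib

/-!
# Frobenioids II, Proposition 3.5 (i)–(iv): the universal closures of the four typed SCHEMATA are false;
# the instance forms that hold (proof-only census of `ArchimedeanIsoSubanchors.lean`)

Mochizuki, *The geometry of Frobenioids II: poly-Frobenioids*, Kyushu J. Math. **62** (2008) 401–460, §3,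
Proposition 3.5 (i)–(iv), kurims p. 34 [cite: MochizukiFrdII2008, Prop 3.5 p.34]: in the notation of Example
3.3 (`F ∈ {C, A}`, `G ∈ {N, R}`, `H ∈ {F, G}`, base `D → D₀` of RC-iso-subanchor type) "(i) [mono-minimal
categorical quotients of `D` lift to pull-back morphisms of `H`]; (ii) the Frobenioid `F` is quasi-isotropic;
(iii) `G` is of RC-iso-subanchor type; (iv) `F` is not of RC-iso-subanchor type."

The statement file `ArchimedeanIsoSubanchors.lean` (abc-iut-L1-t9) types each item as a `Prop`-valued
PREDICATE — `ArchFrd.Prop35i G F ι`, `ArchFrd.Prop35ii G F`, `ArchFrd.Prop35iii G F ι`, `ArchFrd.Prop35iv G F` —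
over an ARBITRARY base functor `G : D → D₀ = ArchBase`, an ARBITRARY pre-Frobenioid structure functor
`F : X → F_Φ` and an ARBITRARY functor `ι : H → X`; the printed claim is the value of the predicate at the
Example 3.3 data (`ArchimedeanTheoremsInstances.lean`: `Prop35i_C`, …, `Prop35iv_A`).  This PROOF-ONLY file
(abc-iut cell, F fact-proving wave, seat abc-iut-f-012; FACT-LIST rows F-0854 `Prop35i`, F-0699 `Prop35ii`,
F-1301 `Prop35iii`, F-0855 `Prop35iv`) records the kernel census of the four schemata:

**Universal closures — all four REFUTED** (so none of the four schema rows is an admissible hypothesis;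
only instance forms are):
* `not_forall_prop35i` — from finding P35i-F1 (`ArchFrd.not_prop35i_C_collapse`, abc-iut-w4-d027/w4-d100,
  `ArchimedeanProp35iCounterexample.lean`): over the base `D₀` with the Galois-collapsing functor, connected,
  totally epimorphic and of RC-iso-subanchor type, (i) fails for `H = C` (print needs Galois saturation of
  `G_D`; repaired statement `ArchFrd.Prop35iR`, proved as `QuotientLift.prop35iR_C_holds`);
* `not_forall_prop35ii` — NEW closed witness `not_prop35ii_const`: over THE base of [IUTchI] Ex. 3.4 (i)
  (`ptBase`, of RC-iso-subanchor type) take for `F` the one-object structure `X = D = •`, `F ≡ •` (the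
  constant functor to `F_Φ`): its object is isotropic (every arrow is an isomorphism) AND an iso-subanchor (it
  is an anchor — no irreducible arrows — and the identity is a mono-minimal quotient by the trivial group,
  [FrdI] §0), so "non-isotropic ⟺ iso-subanchor" fails.  What the witness exploits: the schema's binder `F`
  ranges over ALL structure functors, not over the Frobenioids `C`, `A` of Example 3.3 (for which (ii) is
  PROVED, see below); nothing is said about print;
* `not_forall_prop35iii` — from finding P35iii-F1 (`ArchFrd.not_prop35iii_N_collapse`, abc-iut-w4-d027,
  `ArchimedeanProp35iiiCounterexample.lean`): (iii) fails for `N` over the Galois-collapsing base;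
* `not_forall_prop35iv` — two closed witnesses: `not_prop35iv_empty` (abc-iut-w4-d027's
  `not_prop35iv_C_of_isEmpty` at the EMPTY base: print's standing "`D` connected" is load-bearing) and the NEW
  `not_prop35iv_const` (the one-object structure over `ptBase` IS of RC-iso-subanchor type: print's "`F` is a
  Frobenioid" — Frobenius morphisms of every prime degree, [FrdI] Prop. 1.10 (iv) — is load-bearing; cf. the
  generic PROVED form `ArchFrd.prop35iv_of_isFrobenioid`).

**Instance forms that HOLD, with the schema as head symbol** (all by name from landed files; the
hypothesis-free ones are at THE archimedean base `ptBase = Spec ℂ` of [IUTchI] Ex. 3.4 (i), the base the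
[IUTchIII] cone reads [FrdII] §3 at): `prop35i_ptBase_C/_A/_N` (via abc-iut-w4-d100's saturation criterion,
`prop35i_all_of_saturated` + `galoisSaturated_of_isComplex`), `prop35i_R` (every base, `Prop35i_R_holds`),
`prop35ii_ptBase_C/_A` (`prop35ii_C/A_ptBase`; every totally epimorphic base: `prop35ii_C`, `prop35ii_A`),
`prop35iii_ptBase_N` (`prop35iii_N_ptBase`), `prop35iii_R` (every base, `prop35iii_R_holds`),
`prop35iv_ptBase_C/_A` (`prop35iv_C/A_ptBase`; every Frobenioid on a nonempty category:
`prop35iv_of_isFrobenioid`).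

No definitions (the one-object structure is the term `(Functor.const _).obj (ElemFrobenioid.of _ _)`); no
statement of the paper is re-typed or strengthened; a refuted universal closure of OUR schema is a statement
about the typing's binders, not about [FrdII]; no side is taken on [IUTchIII] Cor. 3.12; typed ≠ proved except
where a `theorem` says so.
-/

namespace Literature.AlgebraicGeometry.Frobenioids

open CategoryTheory

noncomputable section

namespace ArchFrd

universe v u

variable {D : Type u} [Category.{v} D] (π : D ⥤ D0)

/-! ### Proposition 3.5 (i) -/

/-- **(i), closed refuting instance with head `Prop35i`**: finding P35i-F1 restated through the schema —
over `D₀` with the Galois-collapsing functor `D0.collapse` (connected, totally epimorphic, of RC-iso-subanchor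
type) the schema fails for `H = C = C₀ ×_{D₀} D₀`, `ι = 𝟭`. [cite: MochizukiFrdII2008, Prop 3.5 (i) p.34] -/
theorem not_prop35i_collapse :
    ¬ Prop35i (baseRC D0.collapse) (C.toElem D0.collapse) (𝟭 (C D0.collapse)) :=
  not_prop35i_C_collapse

/-- **The universal closure of the schema `Prop35i` is FALSE** (FACT-LIST F-0854: not an admissible
hypothesis; instance forms only). [cite: MochizukiFrdII2008, Prop 3.5 (i) p.34] -/
theorem not_forall_prop35i :
    ¬ ∀ (D : Type) [Category.{0} D] (G : D ⥤ ArchBase) (Ψ : Dᵒᵖ ⥤ CommMonCat.{0})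
        (X : Type) [Category.{0} X] (F : X ⥤ ElemFrobenioid Ψ) (H : Type) [Category.{0} H] (ι : H ⥤ X),
        Prop35i G F ι :=
  fun h => not_prop35i_collapse (h D0 (baseRC D0.collapse) (Φ D0.collapse) (C D0.collapse)
    (C.toElem D0.collapse) (C D0.collapse) (𝟭 (C D0.collapse)))

/-- **(i) at THE archimedean base of [IUTchI] Ex. 3.4 (i), `H = C`** — PROVED (every quotient datum over the
purely complex base `ptBase` is Galois-saturated, abc-iut-w4-d100's criterion).
[cite: MochizukiFrdII2008, Prop 3.5 (i) p.34] -/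
theorem prop35i_ptBase_C : Prop35i (baseRC ptBase) (C.toElem ptBase) (𝟭 (C ptBase)) :=
  (prop35i_all_of_saturated ptBase fun _ _ fD GD _ => galoisSaturated_of_isComplex ptBase fD GD rfl).1

/-- **(i) at the base of [IUTchI] Ex. 3.4 (i), `H = A`** (the angular Frobenioid with its own structure) —
PROVED. [cite: MochizukiFrdII2008, Prop 3.5 (i) p.34] -/
theorem prop35i_ptBase_A : Prop35i (baseRC ptBase) (A.toElem ptBase) (𝟭 (A ptBase)) :=
  (prop35i_all_of_saturated ptBase fun _ _ fD GD _ => galoisSaturated_of_isComplex ptBase fD GD rfl).2.1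

/-- **(i) at the base of [IUTchI] Ex. 3.4 (i), `H = N`** (terminology via `N → C`) — PROVED.
[cite: MochizukiFrdII2008, Prop 3.5 (i) p.34] -/
theorem prop35i_ptBase_N : Prop35i (baseRC ptBase) (C.toElem ptBase) (N.toC ptBase) :=
  (prop35i_all_of_saturated ptBase fun _ _ fD GD _ => galoisSaturated_of_isComplex ptBase fD GD rfl).2.2.1

/-- **(i) for `H = R` over EVERY base `π : D → D₀`** — PROVED (abc-iut-w4-d100's `Prop35i_R_holds`: the
rigidification pins every scalar, so no saturation is needed). [cite: MochizukiFrdII2008, Prop 3.5 (i) p.34] -/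
theorem prop35i_R : Prop35i (baseRC π) (C.toElem π) (R.toC π) :=
  Prop35i_R_holds π

/-! ### Proposition 3.5 (ii) -/

/-- **(ii), closed refuting instance with head `Prop35ii`**: over the base `ptBase` (of RC-iso-subanchor
type) the ONE-OBJECT structure `• → F_Φ` violates "non-isotropic ⟺ iso-subanchor": its object is isotropic
(all arrows are isomorphisms) and an iso-subanchor (an anchor, no irreducible arrows; the identity is a
mono-minimal quotient by the trivial group, [FrdI] §0 p. 18). The schema's `F` ranges over all structure
functors, not only over `C`, `A`. [cite: MochizukiFrdII2008, Prop 3.5 (ii) p.34] -/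
theorem not_prop35ii_const :
    ¬ Prop35ii (baseRC ptBase)
        ((Functor.const (Discrete PUnit.{1})).obj (ElemFrobenioid.of (Φ ptBase) ⟨PUnit.unit⟩)) := by
  intro h
  refine ((h ptBase_isOfRCIsoSubanchorType ⟨PUnit.unit⟩).2 ?_) ?_
  · -- the object is an iso-subanchor
    refine ⟨⟨PUnit.unit⟩, ⊥, 𝟙 _, ⟨⟨PUnit.unit⟩, ?_, ⟨𝟙 _⟩⟩,
      PadicFrd.isTotallyEpimorphic_discretePUnit.isMonoMinimalQuotient_bot_of_isIso (𝟙 _)⟩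
    refine Set.Finite.subset Set.finite_empty ?_
    rintro x ⟨f, hf, -⟩
    exact (hf.1 inferInstance).elim
  · -- the object is isotropic
    intro B ψ _ _
    infer_instance

/-- **The universal closure of the schema `Prop35ii` is FALSE** (FACT-LIST F-0699: not an admissible
hypothesis; instance forms only). [cite: MochizukiFrdII2008, Prop 3.5 (ii) p.34] -/
theorem not_forall_prop35ii :
    ¬ ∀ (D : Type) [Category.{0} D] (G : D ⥤ ArchBase) (Ψ : Dᵒᵖ ⥤ CommMonCat.{0})
        (X : Type) [Category.{0} X] (F : X ⥤ ElemFrobenioid Ψ), Prop35ii G F :=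
  fun h => not_prop35ii_const (h (Discrete PUnit.{1}) (baseRC ptBase) (Φ ptBase) (Discrete PUnit.{1})
    ((Functor.const (Discrete PUnit.{1})).obj (ElemFrobenioid.of (Φ ptBase) ⟨PUnit.unit⟩)))

/-- **(ii) at THE archimedean base of [IUTchI] Ex. 3.4 (i), `F = C_v`** — PROVED (abc-iut-w4-d092's
`prop35ii_C`, hypothesis-free there: abc-iut-w4-d027's `prop35ii_C_ptBase`).
[cite: MochizukiFrdII2008, Prop 3.5 (ii) p.34] -/
theorem prop35ii_ptBase_C : Prop35ii (baseRC ptBase) (C.toElem ptBase) :=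
  prop35ii_C_ptBase

/-- **(ii) at the base of [IUTchI] Ex. 3.4 (i), `F = A_v`** — PROVED (`prop35ii_A_ptBase`).
[cite: MochizukiFrdII2008, Prop 3.5 (ii) p.34] -/
theorem prop35ii_ptBase_A : Prop35ii (baseRC ptBase) (A.toElem ptBase) :=
  prop35ii_A_ptBase

/-- **(ii) for `F = C` over every TOTALLY EPIMORPHIC base** (Example 3.3's standing hypothesis) — PROVED
(abc-iut-w4-d092's `prop35ii_C`), schema-headed. [cite: MochizukiFrdII2008, Prop 3.5 (ii) p.34] -/
theorem prop35ii_C_of_isTotallyEpimorphic (hTE : IsTotallyEpimorphic D) :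
    Prop35ii (baseRC π) (C.toElem π) :=
  prop35ii_C π hTE

/-- **(ii) for `F = A` over every totally epimorphic base** — PROVED (`prop35ii_A`), schema-headed.
[cite: MochizukiFrdII2008, Prop 3.5 (ii) p.34] -/
theorem prop35ii_A_of_isTotallyEpimorphic (hTE : IsTotallyEpimorphic D) :
    Prop35ii (baseRC π) (A.toElem π) :=
  prop35ii_A π hTE

/-! ### Proposition 3.5 (iii) -/

/-- **(iii), closed refuting instance with head `Prop35iii`**: finding P35iii-F1 restated through the schema
— over `D₀` with the Galois-collapsing functor the angloid `N` is not of RC-iso-subanchor type.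
[cite: MochizukiFrdII2008, Prop 3.5 (iii) p.34] -/
theorem not_prop35iii_collapse :
    ¬ Prop35iii (baseRC D0.collapse) (C.toElem D0.collapse) (N.toC D0.collapse) :=
  not_prop35iii_N_collapse

/-- **The universal closure of the schema `Prop35iii` is FALSE** (FACT-LIST F-1301: not an admissible
hypothesis; instance forms only). [cite: MochizukiFrdII2008, Prop 3.5 (iii) p.34] -/
theorem not_forall_prop35iii :
    ¬ ∀ (D : Type) [Category.{0} D] (G : D ⥤ ArchBase) (Ψ : Dᵒᵖ ⥤ CommMonCat.{0})
        (X : Type) [Category.{0} X] (F : X ⥤ ElemFrobenioid Ψ) (H : Type) [Category.{0} H] (ι : H ⥤ X),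
        Prop35iii G F ι :=
  fun h => not_prop35iii_collapse (h D0 (baseRC D0.collapse) (Φ D0.collapse) (C D0.collapse)
    (C.toElem D0.collapse) (N D0.collapse) (N.toC D0.collapse))

/-- **(iii) at THE archimedean base of [IUTchI] Ex. 3.4 (i), `G = N`** — PROVED (abc-iut-w4-d027's
`prop35iii_N_ptBase`: every quotient datum over the purely complex base is saturated).
[cite: MochizukiFrdII2008, Prop 3.5 (iii) p.34] -/
theorem prop35iii_ptBase_N : Prop35iii (baseRC ptBase) (C.toElem ptBase) (N.toC ptBase) :=
  prop35iii_N_ptBase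

/-- **(iii) for `G = R` over EVERY base `π : D → D₀`** — PROVED (abc-iut-w4-d027's `prop35iii_R_holds`),
schema-headed. [cite: MochizukiFrdII2008, Prop 3.5 (iii) p.34] -/
theorem prop35iii_R : Prop35iii (baseRC π) (C.toElem π) (R.toC π) :=
  prop35iii_R_holds π

/-! ### Proposition 3.5 (iv) -/

/-- **(iv), closed refuting instance with head `Prop35iv`, empty base**: over the EMPTY base both `D` and
`C = C₀ ×_{D₀} D` are vacuously of RC-iso-subanchor type (abc-iut-w4-d027's `not_prop35iv_C_of_isEmpty`; print's
standing "`D` connected" is load-bearing). [cite: MochizukiFrdII2008, Prop 3.5 (iv) p.34] -/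
theorem not_prop35iv_empty :
    ¬ Prop35iv (baseRC (Functor.empty D0 : Discrete PEmpty.{1} ⥤ D0))
        (C.toElem (Functor.empty D0 : Discrete PEmpty.{1} ⥤ D0)) :=
  not_prop35iv_C_of_isEmpty (Functor.empty D0 : Discrete PEmpty.{1} ⥤ D0)

/-- **(iv), closed refuting instance with head `Prop35iv`, nonempty base**: over `ptBase` the ONE-OBJECT
structure `• → F_Φ` IS of RC-iso-subanchor type (its object is complex and an RC-anchor of `X[ℂ] = X`, the
identity a mono-minimal quotient by the trivial group) — print's "`F` is a Frobenioid" is load-bearing (cf.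
`prop35iv_of_isFrobenioid`). [cite: MochizukiFrdII2008, Prop 3.5 (iv) p.34] -/
theorem not_prop35iv_const :
    ¬ Prop35iv (baseRC ptBase)
        ((Functor.const (Discrete PUnit.{1})).obj (ElemFrobenioid.of (Φ ptBase) ⟨PUnit.unit⟩)) := by
  intro h
  refine h ptBase_isOfRCIsoSubanchorType ⟨fun X => ⟨X, ⊥, 𝟙 X, ⟨X, ⟨D0.isComplex_specComplex, ?_⟩, ⟨𝟙 X⟩⟩,
    PadicFrd.isTotallyEpimorphic_discretePUnit.isMonoMinimalQuotient_bot_of_isIso (𝟙 X)⟩⟩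
  refine Set.Finite.subset Set.finite_empty ?_
  rintro x ⟨f, hf, -⟩
  refine (hf.1 ?_).elim
  haveI : IsIso f.hom.hom := inferInstance
  exact (ObjectProperty.isIso_hom_iff f.hom).mp inferInstance

/-- **The universal closure of the schema `Prop35iv` is FALSE** (FACT-LIST F-0855: not an admissible
hypothesis; instance forms only). [cite: MochizukiFrdII2008, Prop 3.5 (iv) p.34] -/
theorem not_forall_prop35iv :
    ¬ ∀ (D : Type) [Category.{0} D] (G : D ⥤ ArchBase) (Ψ : Dᵒᵖ ⥤ CommMonCat.{0})
        (X : Type) [Category.{0} X] (F : X ⥤ ElemFrobenioid Ψ), Prop35iv G F :=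
  fun h => not_prop35iv_const (h (Discrete PUnit.{1}) (baseRC ptBase) (Φ ptBase) (Discrete PUnit.{1})
    ((Functor.const (Discrete PUnit.{1})).obj (ElemFrobenioid.of (Φ ptBase) ⟨PUnit.unit⟩)))

/-- **(iv) at THE archimedean base of [IUTchI] Ex. 3.4 (i), `F = C_v`** — PROVED (abc-iut-w4-d027's
`prop35iv_C_ptBase`: `C_v` is a Frobenioid, `Cpt.isFrobenioid`). [cite: MochizukiFrdII2008, Prop 3.5 (iv) p.34] -/
theorem prop35iv_ptBase_C : Prop35iv (baseRC ptBase) (C.toElem ptBase) :=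
  prop35iv_C_ptBase

/-- **(iv) at the base of [IUTchI] Ex. 3.4 (i), `F = A_v`** — PROVED (`prop35iv_A_ptBase`).
[cite: MochizukiFrdII2008, Prop 3.5 (iv) p.34] -/
theorem prop35iv_ptBase_A : Prop35iv (baseRC ptBase) (A.toElem ptBase) :=
  prop35iv_A_ptBase

/-! ### The census, packaged -/

/-- **Census of the four schemata of `ArchimedeanIsoSubanchors.lean`**: each universal closure is false, and
each schema holds at THE archimedean base `ptBase` of [IUTchI] Ex. 3.4 (i) for the Example 3.3 categories it
speaks about (`C`, `A`; `N`, `R`). [cite: MochizukiFrdII2008, Prop 3.5 p.34] -/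
theorem prop35_schema_census :
    (¬ ∀ (D : Type) [Category.{0} D] (G : D ⥤ ArchBase) (Ψ : Dᵒᵖ ⥤ CommMonCat.{0})
        (X : Type) [Category.{0} X] (F : X ⥤ ElemFrobenioid Ψ) (H : Type) [Category.{0} H] (ι : H ⥤ X),
        Prop35i G F ι) ∧
    (¬ ∀ (D : Type) [Category.{0} D] (G : D ⥤ ArchBase) (Ψ : Dᵒᵖ ⥤ CommMonCat.{0})
        (X : Type) [Category.{0} X] (F : X ⥤ ElemFrobenioid Ψ), Prop35ii G F) ∧
    (¬ ∀ (D : Type) [Category.{0} D] (G : D ⥤ ArchBase) (Ψ : Dᵒᵖ ⥤ CommMonCat.{0})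
        (X : Type) [Category.{0} X] (F : X ⥤ ElemFrobenioid Ψ) (H : Type) [Category.{0} H] (ι : H ⥤ X),
        Prop35iii G F ι) ∧
    (¬ ∀ (D : Type) [Category.{0} D] (G : D ⥤ ArchBase) (Ψ : Dᵒᵖ ⥤ CommMonCat.{0})
        (X : Type) [Category.{0} X] (F : X ⥤ ElemFrobenioid Ψ), Prop35iv G F) ∧
    (Prop35i (baseRC ptBase) (C.toElem ptBase) (𝟭 (C ptBase)) ∧
      Prop35i (baseRC ptBase) (A.toElem ptBase) (𝟭 (A ptBase)) ∧
      Prop35i (baseRC ptBase) (C.toElem ptBase) (N.toC ptBase) ∧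
      Prop35i (baseRC ptBase) (C.toElem ptBase) (R.toC ptBase)) ∧
    (Prop35ii (baseRC ptBase) (C.toElem ptBase) ∧ Prop35ii (baseRC ptBase) (A.toElem ptBase)) ∧
    (Prop35iii (baseRC ptBase) (C.toElem ptBase) (N.toC ptBase) ∧
      Prop35iii (baseRC ptBase) (C.toElem ptBase) (R.toC ptBase)) ∧
    (Prop35iv (baseRC ptBase) (C.toElem ptBase) ∧ Prop35iv (baseRC ptBase) (A.toElem ptBase)) :=
  ⟨not_forall_prop35i, not_forall_prop35ii, not_forall_prop35iii, not_forall_prop35iv,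
    ⟨prop35i_ptBase_C, prop35i_ptBase_A, prop35i_ptBase_N, prop35i_R ptBase⟩,
    ⟨prop35ii_ptBase_C, prop35ii_ptBase_A⟩, ⟨prop35iii_ptBase_N, prop35iii_R ptBase⟩,
    ⟨prop35iv_ptBase_C, prop35iv_ptBase_A⟩⟩

end ArchFrd

end

end Literature.AlgebraicGeometry.Frobenioids
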